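import Literature.Geometry.Lorentzian.StationaryBlackHoleUniqueness
import HarnessLib

/-!
# Uniqueness of `I⁺`-regular stationary AXISYMMETRIC vacuum black holes, no analyticity
# (Chruściel–Costa–Heusler 2012, Thm. 3.2; Chruściel–Costa 2008, §§5–7; Chruściel–Galloway 2010)

Cite/fact item `wi-27013` (crux idea `Ideas/global-horizon-generator-dichotomy.md`, route
`FinalStateConjecture/ZeroEnergyKerrOrBomb`, branch (TK) of `GeneratorDichotomy`): the axisymmetric
instance of the rigidity schema `AlexakisIonescuKlainermanRigidity` of `BlackHoles.lean` — sibling of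
the ANALYTIC instance `ChruscielCosta2008_uniqueness` (`StationaryBlackHoleUniqueness.lean`), with
analyticity replaced by an a-priori axisymmetric Killing field.  ONE named fact (D-0014), its
hypothesis form, one proved comparison, and the abbreviation `IsStationaryAxisymmetric` naming
its axisymmetry hypothesis (a definition with body, no debt).

## The printed statement

P. T. Chruściel, J. L. Costa, M. Heusler, *Stationary black holes: uniqueness and beyond*, Living
Rev. Relativity 15 (2012) 7 = arXiv:1205.6112, §3.2 "Stationary-axisymmetric solutions" (p. 10:
"Here one assumes from the outset that, in addition to the stationary Killing vector, there exists
a second Killing vector field. Assuming `I⁺`-regularity, one can invoke the positive energy theorem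
to show [Beig–Chruściel] that some linear combination of the Killing vectors must have periodic
orbits, and an axis of rotation") and §3.2.7, **Theorem 3.2** ("The axisymmetric uniqueness
theorem"), verbatim: "Let `(M, g)` be a stationary, axisymmetric asymptotically-flat, `I⁺`-regular,
electrovacuum four-dimensional spacetime. Then the domain of outer communications `⟨⟨M_ext⟩⟩` is
isometric to one of the Weinstein solutions. In particular, if the event horizon is connected, then
`⟨⟨M_ext⟩⟩` is isometric to the domain of outer communications of a Kerr–Newman spacetime."
NO analyticity is assumed (§3.3.1, p. 11: analyticity enters the general no-hair theorem only
through Hawking's rigidity "stationary ⇒ static or axisymmetric", which is a hypothesis here).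
Proof ingredients as cited there: Chruściel–Costa, Astérisque 321 (2008) = arXiv:0806.0016, §5
(the area function; Thm. 5.4 under analyticity and **Thm. 5.6**: "Let `n = 3`, `s = 2` and, under
the remaining conditions of Theorem 5.4, instead of analyticity assume that `(M, g)` is
`I⁺`-regular. Then the conclusion of Theorem 5.4 holds"), §6 (reduction to harmonic maps,
Weinstein/Robinson uniqueness; arXiv p. 32: "no non-degenerate axisymmetric vacuum black holes
with `|a| ≥ m` exist"), §7; prehorizons: Chruściel–Galloway, Class. Quantum Grav. 27 (2010) 152001 =
arXiv:1004.0513, Thm. 1.1.  (Chruściel–Costa 2008, Remark 1.6 — "analyticity … can be replaced by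
the condition of axisymmetry and `I⁺`-regularity" — is printed after the STATIC Theorem 1.4.)

## What is vendored (weaker than printed), hypothesis by hypothesis

`ChruscielCostaHeusler2012_axisymmetricUniqueness` := the schema `AlexakisIonescuKlainermanRigidity` at
the predicate "`𝓑.IsIPlusRegularNonDegenerate` and `𝓑` carries an axisymmetric Killing field `Y`
commuting with the stationary one": for every `𝓑 : StationaryAFBlackHole` (a four-dimensional
space-time with complete stationary Killing field `T = 𝓑.killing` timelike on `M_ext`, AF end:
**stationary, asymptotically flat, four-dimensional**) which is `I⁺`-regular
(`StationaryAFBlackHole.IsIPlusRegular`, Chruściel–Costa Def. 1.1 = CCH Def. 2.1: **`I⁺`-regular**),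
has **connected** horizon `𝓔⁺` and a non-degenerate horizon Killing field
(`IsNonDegenerateHorizon`; an EXTRA hypothesis, not in Thm. 3.2 — it only weakens the fact and is what
makes the Kerr member subextremal, exactly as for `ChruscielCosta2008_uniqueness`), carries a Killing
field `Y` which is complete with `2π`-periodic orbits, non-trivial and with non-empty axis
(`Spacetime.IsAxisymmetricKilling`, Heusler Def. 2.6 — STRONGER than CCH's "a second Killing vector
field", hence again only weakening) and commutes with `T` (`[T, Y] = 0`, extra), and is **vacuum**
(`Ric(g) = 0` ⊆ electrovacuum): the d.o.c. `⟨⟨M_ext⟩⟩` is isometric to a subextremal Kerr exterior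
(`IsIsometricToKerrExterior`; "Kerr–Newman" with `F = 0` is Kerr, and a Kerr space-time with a
non-empty connected NON-DEGENERATE horizon is subextremal, `|a| < M`, Chruściel–Costa 2008 §6:
"no non-degenerate axisymmetric vacuum black holes with `|a| ≥ m` exist").  Every hypothesis implies
the corresponding printed one, so the vendored `Prop` is implied by Theorem 3.2.

Not vendored: the electrovacuum/Kerr–Newman and multi-component (Weinstein) conclusions, the
degenerate (extremal) case, Beig–Chruściel's theorem on isometry groups (CMP 188 (1997), Thm. 1.2)
which produces the periodic Killing field from any second one.

## References

* P. T. Chruściel, J. L. Costa, M. Heusler, Living Rev. Relativity 15 (2012) 7, arXiv:1205.6112,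
  §3.2 (p. 10) and Thm. 3.2 (p. 11) (key `ChruscielCostaHeusler2012`).
* P. T. Chruściel, J. L. Costa, Astérisque 321 (2008) 195–265, arXiv:0806.0016, Def. 1.1, §5
  (Thms. 5.4, 5.6, Def. 5.7), §§6–7 (key `ChruscielCosta2008`).
* P. T. Chruściel, G. J. Galloway, Class. Quantum Grav. 27 (2010) 152001, arXiv:1004.0513, Thm. 1.1
  (key `ChruscielGalloway2010`).
-/

noncomputable section

open scoped Manifold ContDiff

universe u

namespace Literature.Geometry.Lorentzian

namespace StationaryAFBlackHole

/-- The stationary AF black hole `𝓑` is **stationary-axisymmetric** in the strong sense used here: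
it carries a Killing field `Y` which is axisymmetric (`Spacetime.IsAxisymmetricKilling`: complete,
all integral curves `2π`-periodic, not identically zero, with non-empty axis) and commutes with the
stationary Killing field `T = 𝓑.killing` (`[T, Y] = 0`, Mathlib `VectorField.mlieBracket`), so that
the two flows generate an isometric `ℝ × U(1)`-action.  Quantified over the standing Levi-Civita
hypothesis like `IsIPlusRegularNonDegenerate`.  An abbreviation (a predicate on `𝓑`, nothing to
discharge). Chruściel–Costa–Heusler 2012, §3.2; Heusler 1996, Def. 2.6. [cite: ChruscielCostaHeusler2012, §3.2 (p. 10)] -/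
abbrev IsStationaryAxisymmetric (𝓑 : StationaryAFBlackHole.{u}) : Prop :=
  ∀ [𝓑.metric.HasLeviCivita], ∃ Y : Π x : 𝓑.carrier, TangentSpace (𝓡 4) x,
    𝓑.toSpacetime.IsAxisymmetricKilling Y ∧ ∀ x, VectorField.mlieBracket (𝓡 4) 𝓑.killing Y x = 0

end StationaryAFBlackHole

/-- **Uniqueness of `I⁺`-regular stationary axisymmetric vacuum black holes with connected
non-degenerate horizon — no analyticity** (Chruściel–Costa–Heusler 2012, Thm. 3.2, vacuum case of
the "in particular" clause: "Let `(M, g)` be a stationary, axisymmetric asymptotically-flat,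
`I⁺`-regular, electrovacuum four-dimensional spacetime. … In particular, if the event horizon is
connected, then `⟨⟨M_ext⟩⟩` is isometric to the domain of outer communications of a Kerr–Newman
spacetime"; proof: Chruściel–Costa 2008 §§5–7 with Thm. 5.6 replacing analyticity by
`I⁺`-regularity in the axisymmetric four-dimensional case, and Chruściel–Galloway 2010 Thm. 1.1).
Vendored as the Alexakis–Ionescu–Klainerman rigidity schema of `BlackHoles.lean` at the predicate
"`I⁺`-regular with connected non-degenerate horizon (`IsIPlusRegularNonDegenerate`) and
stationary-axisymmetric (`IsStationaryAxisymmetric`)": every such VACUUM stationary AF black hole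
has d.o.c. isometric to a subextremal Kerr exterior (`IsIsometricToKerrExterior`).  The extra
hypotheses (non-degenerate horizon Killing field; periodic `Y` with axis, commuting with `T`) only
weaken the statement relative to Thm. 3.2; non-degeneracy is what makes the Kerr member
subextremal (Chruściel–Costa 2008, §6).  Named fact (D-0014); users take
`(h : ChruscielCostaHeusler2012_axisymmetricUniqueness)`.
[cite: ChruscielCostaHeusler2012, Thm. 3.2 (§3.2.7, arXiv p. 11) and §3.2 (p. 10)]
[cite: ChruscielCosta2008, §5 Thm. 5.6 and §§6–7] [cite: ChruscielGalloway2010, Thm. 1.1] -/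
def ChruscielCostaHeusler2012_axisymmetricUniqueness : Prop :=
  AlexakisIonescuKlainermanRigidity.{u} fun 𝓑 ↦
    𝓑.IsIPlusRegularNonDegenerate ∧ 𝓑.IsStationaryAxisymmetric

/-- Hypothesis form: given the named fact, an `I⁺`-regular vacuum stationary AF black hole with
connected non-degenerate horizon and an axisymmetric Killing field commuting with the stationary
one has d.o.c. isometric to a subextremal Kerr exterior — without any analyticity assumption.
Tautological unfolding. Chruściel–Costa–Heusler 2012, Thm. 3.2. [cite: ChruscielCostaHeusler2012, Thm. 3.2] -/
theorem ChruscielCostaHeusler2012_axisymmetricUniqueness.apply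
    (h : ChruscielCostaHeusler2012_axisymmetricUniqueness.{u})
    (𝓑 : StationaryAFBlackHole.{u}) [𝓑.metric.HasLeviCivita] [Kerr.Facts]
    (hF : 𝓑.metric.isOpen_chronologicalFuture 𝓑.timeOrientation)
    (hP : 𝓑.metric.isOpen_chronologicalPast 𝓑.timeOrientation)
    (hres : PseudoRiemannianMetric.contMDiff_restrict (I := 𝓡 4) (n := ∞) (M := 𝓑.carrier))
    (hreg : 𝓑.IsIPlusRegular) (hconn : IsConnected 𝓑.horizon)
    (hnd : ∀ [𝓑.metric.HasLeviCivita], 𝓑.toSpacetime.IsNonDegenerateHorizon 𝓑.Mext)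
    (Y : Π x : 𝓑.carrier, TangentSpace (𝓡 4) x) (hY : 𝓑.toSpacetime.IsAxisymmetricKilling Y)
    (hTY : ∀ x, VectorField.mlieBracket (𝓡 4) 𝓑.killing Y x = 0)
    (hvac : 𝓑.metric.toPseudoRiemannianMetric.IsRicciFlat) :
    𝓑.IsIsometricToKerrExterior hF hP hres :=
  h 𝓑 hF hP hres ⟨⟨hreg, hconn, fun {_} ↦ hnd⟩, fun {_} ↦ ⟨Y, hY, hTY⟩⟩ hvac

/-- **The non-analytic uniqueness statement implies the axisymmetric theorem**: if the
Alexakis–Ionescu–Klainerman schema holds at `IsIPlusRegularNonDegenerate` (uniqueness of smooth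
`I⁺`-regular vacuum black holes with connected non-degenerate horizon, the open problem recorded in
`StationaryBlackHoleUniqueness.lean`), then the vendored axisymmetric theorem follows (drop
axisymmetry; antitonicity `AlexakisIonescuKlainermanRigidity.mono`). Tautological.
[cite: ChruscielCostaHeusler2012, Thm. 3.2] -/
theorem ChruscielCostaHeusler2012_axisymmetricUniqueness.of_nonanalytic
    (h : AlexakisIonescuKlainermanRigidity StationaryAFBlackHole.IsIPlusRegularNonDegenerate.{u}) :
    ChruscielCostaHeusler2012_axisymmetricUniqueness.{u} :=
  h.mono fun _ h𝓑 ↦ h𝓑.1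

end Literature.Geometry.Lorentzian
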